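import Literature.Computability.AlgebraicComplexity.BDI20WaringBorderWaringGap
import Literature.Computability.AlgebraicComplexity.BDI20NcABPWidthBorderWaringGap
import Literature.Computability.AlgebraicComplexity.FormTorusInstability
import HarnessLib

/-!
# BDI Cor 6.7 (arXiv Cor 13): ncABP width is preserved under approximation (`B_{k,d}` is Zariski
# closed), eq. (4.1), and Cor 6.8 (arXiv Cor 14) assembled as printed
(theorem-only file; cell `val-lit`, seat x6; no definitions, no named facts)

[BlaserDorflerIkenmeyer2020] §6, after Prop 12: "From this characterization of ncABP size as the
rank of the partial derivative matrices we can also see that ncABP size is preserved under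
approximation. This was remarked by Michael Forbes [For16], but we give a proof for the sake of
completeness. **Corollary 13** (= CCC 2021 Cor 6.7). Let `p ∈ Sym^d V` and `(A_i)_i` be ncABPs s.t.
`A_i` computes `p_i ∈ ⊗^d V` and has size `s_i ≤ s` and width `w_i ≤ w` with `lim_{i→∞} p_i = p`.
Then there is an ncABP `A` computing `p` with size at most `s` and width at most `w`." Proof: "`rk
M_{k,p_i} ≤ w_i ≤ w` … is characterized by all determinants of `(w+1) × (w+1)` minors of `M_{k,p_i}`
vanishing. So by continuity of the determinant also all `(w+1) × (w+1)` minors of `M_{k,p}` vanish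
and thus … there is an ncABP `A` with width at most `w` by Proposition 12" (arXiv p0011.txt:L88-93,
p0012.txt:L1-17; CCC p.29:13). **Corollary 14** (= CCC Cor 6.8): `W_{k,d} ⊆ W̲_{k,d} ⊆ B_{k,d} =
B̲_{k,d}` "and there exist `k,d` for which the inclusions are strict" (p0012.txt:L21-36).

What is here (all PROVED; the statement file `BDI20WaringRankABPWidth.lean` typed Prop 6.6's width
clause and listed Cor 6.7/6.8 and eq. (4.1) as not typed):
* `BDI2020.ncAbpWidth_eq_wordTTRank` — `ncw(Ψ) = max_k rank M_k(Ψ)` (the `sInf` of Def 6.1 is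
  attained at Nisan's tensor-train rank; from the tree's `BDI2020.hasNcABPWidthLE_iff_wordTTRank_le`),
  and `BDI2020.ncAbpWidthPoly_le_iff`.
* `BDI2020_cor_6_7_zariski` — **Cor 6.7, width clause, Zariski form over any field**: if the
  coefficient vector of `p` lies in the Zariski closure of those of the forms `q` with `ncw(q) ≤ w`,
  then `ncw(p) ≤ w` (the printed minors argument: `rank_wordFlattening_symTensor_le_of_mem_zariskiClosure`).
* `BDI2020_cor_6_7` — **Cor 6.7, width clause, as printed over `ℂ`** (coefficientwise limits;
  Euclidean closure ⊆ Zariski closure, `closure_subset_zariskiClosure`).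
* `BDI2020_eq_4_1` — eq. (4.1) "`w(f) ≤ W̲R(f)·(md+d+1)·(d+1)`" (a fortiori from the PROVED sharp
  Thm 4.2 `w(f) ≤ W̲R(f)`, `BDI2020_thm_4_2_holds`; the read-once-oblivious-ABP proof is not followed).
* `BDI2020_cor_6_8` — **Cor 6.8 as printed, over `ℂ`**, one conjunction: (i) `W_{k,d} ⊆ W̲_{k,d}`
  (`borderPolyWaringRank_le_polyWaringRank_of_isHomogeneous`), (ii) `W̲_{k,d} ⊆ B_{k,d}`
  (`BDI2020_thm_4_2_chain_holds`), (iii) `B_{k,d} = B̲_{k,d}` (`BDI2020_cor_6_7_zariski`), (iv) the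
  first strict inclusion (`x^{d-1} y`, `k = 2`, `d = 3`; `BDI2020_cor_6_8_waring_lt_of_border`), (v) the
  second (`tr(X³)` on `2 × 2` matrices, `k = 4`, `d = 3`; `BDI2020_cor_6_8_ncw_lt_border`).

HONEST SCOPE. The SIZE clause of Cor 6.7 (`size ≤ s`, total number of vertices) is not typed: the
tree renders ncABPs by their width only (`BDI2020.HasNcABPWidthLE` pads every layer), as already
disclosed for Prop 6.6. Sets of forms are typed pointwise (`WR(f) ≤ k → W̲R(f) ≤ k`, …) for forms of
degree `d ≥ 1` (the tree's junk conventions at `d = 0`, see `BDI2020_thm_4_2`). Typed ≠ endorsed;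
`VP ≠ VNP` is NOT proved and nothing here bears on it (LADDER-VALIANT V4, row N4, ideation only).

## References
* [BlaserDorflerIkenmeyer2020] M. Bläser, J. Dörfler, C. Ikenmeyer, *On the complexity of
  evaluating highest weight vectors*, arXiv:2002.11594 = CCC 2021 (LIPIcs 200:29): eq. (4.1)
  (arXiv p0006.txt:L55-61; CCC p.29:6), Cor 13 (p0011.txt:L88-93, proof p0012.txt:L1-17; = CCC
  Cor 6.7, p.29:13), Cor 14 (p0012.txt:L21-36; = CCC Cor 6.8, p.29:13–29:14).
* [Forbes2016] M. Forbes, *Some concrete questions on the border complexity of polynomials*, talk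
  at WACT 2016 (the source's [For16] for Cor 13; not opened here).
* [Nisan1991] N. Nisan, *Lower bounds for non-commutative computation*, STOC 1991, Thm. 1.
-/

noncomputable section

open MvPolynomial Finset Filter
open scoped BigOperators Classical Topology

namespace Literature.Computability.AlgebraicComplexity

namespace BDI2020

variable {F : Type*} [Field F] {m : ℕ}

/-- **`ncw(Ψ) = max_k rank M_k(Ψ)`**: by Nisan's width theorem (`hasNcABPWidthLE_iff_wordTTRank_le`)
the least width of an ncABP computing a word tensor is its tensor-train rank ("the `k`-th layer of
`B` has precisely `dim ∂^{=k}(p)` many vertices which is the optimal width").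
[cite: BlaserDorflerIkenmeyer2020, Prop 12 (arXiv; = CCC 2021 Prop 6.6)] -/
theorem ncAbpWidth_eq_wordTTRank {d : ℕ} (Ψ : (Fin d → Fin m) → F) : ncAbpWidth Ψ = wordTTRank Ψ := by
  apply le_antisymm
  · exact ncAbpWidth_le ((hasNcABPWidthLE_iff_wordTTRank_le Ψ).2 le_rfl)
  · have hne : {w | HasNcABPWidthLE w Ψ}.Nonempty := ⟨_, (hasNcABPWidthLE_iff_wordTTRank_le Ψ).2 le_rfl⟩
    exact (hasNcABPWidthLE_iff_wordTTRank_le Ψ).1 (Nat.sInf_mem hne)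

/-- `ncw(f) ≤ w` iff every flattening `M_k` of the symmetric tensor of `f` has rank `≤ w`.
[cite: BlaserDorflerIkenmeyer2020, Prop 12 (arXiv; = CCC 2021 Prop 6.6)] -/
theorem ncAbpWidthPoly_le_iff {d w : ℕ} (f : MvPolynomial (Fin m) F) :
    ncAbpWidthPoly d f ≤ w ↔ ∀ (a b : ℕ) (h : a + b = d), (wordFlattening (symTensor d f) a b h).rank ≤ w := by
  rw [ncAbpWidthPoly, ncAbpWidth_eq_wordTTRank, wordTTRank_le_iff]

end BDI2020

open BDI2020

/-! ### Cor 6.7 (arXiv Cor 13): `B_{w,d}` is closed -/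

/-- **BDI Cor 6.7 (arXiv Cor 13), width clause, Zariski form: `B_{w,d}` is Zariski closed.** If the
coefficient vector of `p` lies in the Zariski closure of (the coefficient vectors of) the polynomials
`q` with `ncw(q) ≤ w`, then `ncw(p) ≤ w`: "`rk M_{k,p_i} ≤ w_i ≤ w` … is characterized by all
determinants of `(w+1) × (w+1)` minors of `M_{k,p_i}` vanishing. So by continuity … all
`(w+1) × (w+1)` minors of `M_{k,p}` vanish and thus … there is an ncABP `A` with width at most `w`
by Proposition 12" — the minors are polynomials in the coefficients, so the printed argument gives
the Zariski statement over any field (tree: `rank_wordFlattening_symTensor_le_of_mem_zariskiClosure`,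
Nisan's `hasNcABPWidthLE_iff_wordTTRank_le`). The SIZE clause of Cor 13 (`size ≤ s`) is not typed
(the tree renders ncABPs by width only). [cite: BlaserDorflerIkenmeyer2020, Cor 13 (arXiv; = CCC 2021 Cor 6.7)]
locator: paper:arxiv-2002.11594 p0011.txt:L88-93 (statement), p0012.txt:L1-17 (proof); CCC p.29:13. -/
theorem BDI2020_cor_6_7_zariski {F : Type*} [Field F] {m d w : ℕ} {p : MvPolynomial (Fin m) F}
    (hp : coeffVec p ∈ zariskiClosure (coeffVec '' {q : MvPolynomial (Fin m) F | ncAbpWidthPoly d q ≤ w})) :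
    ncAbpWidthPoly d p ≤ w :=
  (ncAbpWidthPoly_le_iff p).2 fun a b h =>
    rank_wordFlattening_symTensor_le_of_mem_zariskiClosure hp a b h
      fun q hq => (ncAbpWidthPoly_le_iff q).1 hq a b h

/-- **BDI Cor 6.7 (arXiv Cor 13), width clause, as printed (limits over `ℂ`): "ncABP width is
preserved under approximation."** "Let `p ∈ Sym^d V` and `(A_i)_i` be ncABPs s.t. `A_i` computes
`p_i` and has … width `w_i ≤ w` with `lim_{i→∞} p_i = p`. Then there is an ncABP `A` computing `p`
with … width at most `w`" — with `lim` the coefficientwise limit in `ℂ` and `ncw` the tree's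
`BDI2020.ncAbpWidthPoly`; the size clause is not typed. (Euclidean limits lie in the Zariski
closure, `closure_subset_zariskiClosure`, then `BDI2020_cor_6_7_zariski`.)
[cite: BlaserDorflerIkenmeyer2020, Cor 13 (arXiv; = CCC 2021 Cor 6.7; "This was remarked by Michael Forbes [For16]")]
locator: paper:arxiv-2002.11594 p0011.txt:L88-93; CCC p.29:13. -/
theorem BDI2020_cor_6_7 {m d w : ℕ} {p : MvPolynomial (Fin m) ℂ} (ps : ℕ → MvPolynomial (Fin m) ℂ)
    (hw : ∀ i, ncAbpWidthPoly d (ps i) ≤ w)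
    (hlim : Tendsto (fun i => coeffVec (ps i)) atTop (𝓝 (coeffVec p))) :
    ncAbpWidthPoly d p ≤ w := by
  refine BDI2020_cor_6_7_zariski (closure_subset_zariskiClosure _ ?_)
  exact mem_closure_of_tendsto hlim (Eventually.of_forall fun i => ⟨ps i, hw i, rfl⟩)

/-! ### eq. (4.1) -/

/-- **BDI eq. (4.1)**: "For all `f ∈ ℂ[x_1,…,x_m]_d` we have `w(f) ≤ W̲R(f)·(md+d+1)·(d+1)`" (the
known bound via read-once oblivious ABPs, Saxena/Forbes/Nisan). Here a fortiori from the PROVED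
sharp form Thm 4.2, `w(f) ≤ W̲R(f)` (`BDI2020_thm_4_2_holds`); degree `d ≥ 1` as there.
[cite: BlaserDorflerIkenmeyer2020, eq. (4.1) (arXiv p0006.txt:L55-61 "We conclude: (4.1)"; = CCC 2021 eq. (4.1), p.29:6)] -/
theorem BDI2020_eq_4_1 (m d : ℕ) (f : MvPolynomial (Fin m) ℂ) (hf : f.IsHomogeneous d) (hd : 0 < d) :
    abpWidth d f ≤ borderPolyWaringRank d f * (m * d + d + 1) * (d + 1) := by
  have h := BDI2020_thm_4_2_holds m d f hf hd
  calc abpWidth d f ≤ borderPolyWaringRank d f * 1 * 1 := by simpa using h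
    _ ≤ borderPolyWaringRank d f * (m * d + d + 1) * (d + 1) := by
        gcongr <;> omega

/-! ### Cor 6.8 (arXiv Cor 14) as printed -/

/-- **BDI Cor 6.8 (arXiv Cor 14), as printed, over `ℂ`.** With `W_{k,d} = {p ∈ Sym^d V | WR(p) ≤ k}`,
`W̲_{k,d} = {p | W̲R(p) ≤ k}`, `B_{k,d} = {p | ncw(p) ≤ k}` and `B̲_{k,d}` its closure: "Then
`W_{k,d} ⊆ W̲_{k,d} ⊆ B_{k,d} = B̲_{k,d}` and there exist `k,d` for which the inclusions are strict."
Typed pointwise for forms of degree `d ≥ 1` over the tree's `polyWaringRank`, `borderPolyWaringRank`,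
`BDI2020.ncAbpWidthPoly` and the Zariski closure in coefficient space: (i) `W ⊆ W̲`; (ii) `W̲ ⊆ B`
(Thm 4.2); (iii) `B̲ ⊆ B` (Cor 6.7; `B ⊆ B̲` is `subset_zariskiClosure`); (iv) `W_{2,3} ⊊ W̲_{2,3}`
witnessed by `x²y`; (v) `W̲_{4,3} ⊊ B_{4,3}` witnessed by the `2 × 2` matrix-multiplication cubic.
[cite: BlaserDorflerIkenmeyer2020, Cor 14 (arXiv; = CCC 2021 Cor 6.8)]
locator: paper:arxiv-2002.11594 p0012.txt:L21-52; CCC p.29:13–29:14. -/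
theorem BDI2020_cor_6_8 :
    (∀ (m d k : ℕ) (f : MvPolynomial (Fin m) ℂ), f.IsHomogeneous d → 0 < d →
        polyWaringRank d f ≤ k → borderPolyWaringRank d f ≤ k) ∧
    (∀ (m d k : ℕ) (f : MvPolynomial (Fin m) ℂ), f.IsHomogeneous d → 0 < d →
        borderPolyWaringRank d f ≤ k → ncAbpWidthPoly d f ≤ k) ∧
    (∀ (m d k : ℕ) (f : MvPolynomial (Fin m) ℂ),
        coeffVec f ∈ zariskiClosure (coeffVec '' {q : MvPolynomial (Fin m) ℂ | ncAbpWidthPoly d q ≤ k}) →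
        ncAbpWidthPoly d f ≤ k) ∧
    (∃ (m d k : ℕ) (f : MvPolynomial (Fin m) ℂ), f.IsHomogeneous d ∧ 0 < d ∧
        borderPolyWaringRank d f ≤ k ∧ k < polyWaringRank d f) ∧
    (∃ (m d k : ℕ) (f : MvPolynomial (Fin m) ℂ), f.IsHomogeneous d ∧ 0 < d ∧
        ncAbpWidthPoly d f ≤ k ∧ k < borderPolyWaringRank d f) := by
  refine ⟨fun m d k f hf hd h => (borderPolyWaringRank_le_polyWaringRank_of_isHomogeneous hd hf).trans h,
    fun m d k f hf hd h => (BDI2020_thm_4_2_chain_holds m d f hf hd).2.trans h,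
    fun m d k f hf => BDI2020_cor_6_7_zariski hf, ?_, ?_⟩
  · exact ⟨2, 3, 2, X 0 ^ (3 - 1) * X 1, BDI20WaringGap.isHomogeneous_X_pow_mul_X (by norm_num),
      by norm_num, BDI2020_cor_6_8_waring_lt_of_border le_rfl⟩
  · exact ⟨4, 3, 4, _, BDI20TrCube.isHomogeneous_trCube, by norm_num, BDI2020_cor_6_8_ncw_lt_border⟩

end Literature.Computability.AlgebraicComplexity
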